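import Literature.Computability.ImplicitComplexity.STAEncBasics
import HarnessLib

/-!
# GMR08 completeness infrastructure, III: the "zone" of the multiplexed input string

Support file 3 for the completeness half of
`Literature.Computability.ImplicitComplexity.STACapturesP` (GMR08 Thm. 3.9).

The program deciding a language has the shape `λs.P` where the input string `s : !ᴾ S_m` is used
many times, at many box depths (it drives every nested iteration, GMR08 §3.2/Lemma 3.6: in `STA`
only the rule `(m)` shares an assumption). In de Bruijn form the string is the variable `k` at
binder depth `k`. This file packages the bookkeeping of rule `(m)` for that one distinguished
slot once and for all:

* `Ctx.zone m k L lv` — the context with *local part* `L` on the slots `< k`, the string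
  `s : !ˡᵛ S_m` at slot `k`, and nothing above;
* `HTz r m k L M σ := ∃ lv, HT r (Ctx.zone m k L lv) M σ` — derivability with the string at SOME
  level;
* the derived rules making the string slot behave as an unrestricted hypothesis:
  `HTz.app` (rule `(⊸E)` splitting only the local part and SHARING the string: the two copies are
  renamed apart, the application formed, and the copies merged by a rank-2 multiplexor,
  `HT.zone_app`; levels are first equalised by rank-1 multiplexors, `HT.zone_raise`),
  `HTz.lam`, `HTz.box` (rule `(sp)`), `HTz.allI`/`HTz.allE`, `HTz.svar` (the string itself),
  `HTz.lvar`, `HTz.ofHT`, `HTz.weakenL`, and the final abstraction `HTz.close`: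
  `HTz r m 0 ∅ M B ⟹ ⊢ λs.M : !ᴾ S_m ⊸ B` for some `P`.

## References

* M. Gaboardi, J.-Y. Marion, S. Ronchi Della Rocca, *Soft Linear Logic and Polynomial Complexity
  Classes*, ENTCS 205 (2008) 67–87, doi:10.1016/j.entcs.2008.03.066, Table 2 ((m), (sp)),
  §3.2, Thm. 3.9. [GaboardiMarionRonchidellarocca2008]
* M. Gaboardi, S. Ronchi Della Rocca, *A soft type assignment system for λ-calculus*, CSL 2007,
  LNCS 4646, Lemma 16 / Thm. 17 (the same construction with named variables).
-/

namespace Literature.Computability.ImplicitComplexity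

namespace STA

/-! ### The zone context -/

/-- The string type is closed: shifting its free type variables does nothing. [folklore] -/
theorem tyS_rename_succ (m : ℕ) : (tyS m).rename Nat.succ = tyS m := rfl

/-- `Ctx.zone m k L lv`: local assumptions `L` on the slots `< k`, the input string `s : !ˡᵛ S_m`
at slot `k` (its de Bruijn index at binder depth `k`), nothing above.
[cite: GaboardiMarionRonchidellarocca2008, Thm. 3.9 (the program `λs.…`)] -/
def Ctx.zone (m k : ℕ) (L : Ctx) (lv : ℕ) : Ctx :=
  fun i => if i < k then L i else if i = k then some ⟨lv, tyS m⟩ else none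

section zone

variable {m k : ℕ} {L : Ctx} {lv : ℕ}

/-- `zone_lt` (bookkeeping). [folklore] -/
theorem Ctx.zone_lt {i : ℕ} (hi : i < k) : Ctx.zone m k L lv i = L i := by
  simp [Ctx.zone, hi]

/-- `zone_self` (bookkeeping). [folklore] -/
@[simp] theorem Ctx.zone_self : Ctx.zone m k L lv k = some ⟨lv, tyS m⟩ := by
  simp [Ctx.zone]

/-- `zone_gt` (bookkeeping). [folklore] -/
theorem Ctx.zone_gt {i : ℕ} (hi : k < i) : Ctx.zone m k L lv i = none := by
  simp [Ctx.zone, show ¬(i < k) by omega, show i ≠ k by omega]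

/-- The zone context has support below `k + 1`. [folklore] -/
theorem Ctx.zone_boundedBy (m k : ℕ) (L : Ctx) (lv : ℕ) : (Ctx.zone m k L lv).BoundedBy (k + 1) :=
  fun _ hi => Ctx.zone_gt (by omega)

/-- A nonempty slot of the zone context is a local slot or the string slot. [folklore] -/
theorem Ctx.zone_ne_none {i : ℕ} (h : Ctx.zone m k L lv i ≠ none) : (i < k ∧ L i ≠ none) ∨ k = i := by
  by_cases hi : i < k
  · exact Or.inl ⟨hi, by rwa [Ctx.zone_lt hi] at h⟩
  · by_cases hik : i = k
    · exact Or.inr hik.symm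
    · exact absurd (Ctx.zone_gt (by omega)) h

/-- Entering a binder: the new local slot `0`, the string moves to `k + 1`. [folklore] -/
theorem Ctx.cons_zone (a : Option SoftTy) (m k : ℕ) (L : Ctx) (lv : ℕ) :
    Ctx.cons a (Ctx.zone m k L lv) = Ctx.zone m (k + 1) (Ctx.cons a L) lv := by
  funext i
  cases i with
  | zero => simp [Ctx.cons, Ctx.zone]
  | succ i =>
    simp only [Ctx.cons, Ctx.zone, Nat.succ_lt_succ_iff, Nat.succ_inj]

/-- Rule `(sp)` on a zone context: the locals and the string are promoted. [folklore] -/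
theorem Ctx.zone_bang (m k : ℕ) (L : Ctx) (lv : ℕ) :
    (Ctx.zone m k L lv).bang = Ctx.zone m k L.bang (lv + 1) := by
  funext i
  by_cases hi : i < k
  · simp [Ctx.bang, Ctx.zone, hi]
  · by_cases hik : i = k
    · subst hik; simp [Ctx.bang, Ctx.zone, SoftTy.bang]
    · simp [Ctx.bang, Ctx.zone, hi, hik]

/-- Iterated `(sp)`. [folklore] -/
theorem Ctx.zone_bang_iterate (m k : ℕ) (L : Ctx) (lv n : ℕ) :
    Ctx.bang^[n] (Ctx.zone m k L lv) = Ctx.zone m k (Ctx.bang^[n] L) (lv + n) := by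
  induction n generalizing L lv with
  | zero => rfl
  | succ n ih =>
    rw [Function.iterate_succ_apply, Function.iterate_succ_apply, Ctx.zone_bang, ih]
    congr 1
    omega

/-- Rule `(∀I)` on a zone context: the string type is closed. [folklore] -/
theorem Ctx.zone_shift (m k : ℕ) (L : Ctx) (lv : ℕ) :
    (Ctx.zone m k L lv).shift = Ctx.zone m k L.shift lv := by
  funext i
  by_cases hi : i < k
  · simp [Ctx.shift, Ctx.zone, hi]
  · by_cases hik : i = k
    · subst hik
      simp [Ctx.shift, Ctx.zone, SoftTy.shift, tyS_rename_succ]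
    · simp [Ctx.shift, Ctx.zone, hi, hik]

/-- The zone only reads the local part below `k`. [folklore] -/
theorem Ctx.zone_congr {L L' : Ctx} (h : ∀ i < k, L i = L' i) (m lv : ℕ) :
    Ctx.zone m k L lv = Ctx.zone m k L' lv := by
  funext i
  by_cases hi : i < k
  · rw [Ctx.zone_lt hi, Ctx.zone_lt hi, h i hi]
  · by_cases hik : i = k
    · subst hik; simp
    · rw [Ctx.zone_gt (by omega), Ctx.zone_gt (by omega)]

/-- At depth `0` the zone context is the one-slot context of the string. [folklore] -/
theorem Ctx.zone_zero (m : ℕ) (L : Ctx) (lv : ℕ) :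
    Ctx.zone m 0 L lv = Ctx.cons (some ⟨lv, tyS m⟩) Ctx.empty := by
  funext i
  cases i with
  | zero => simp [Ctx.zone, Ctx.cons]
  | succ i => simp [Ctx.zone, Ctx.cons, Ctx.empty]

end zone

/-! ### Raising the level of the string and sharing it in an application -/

namespace HT

variable {r m k : ℕ} {L : Ctx} {lv : ℕ} {M : Term} {σ : SoftTy}

/-- **Raising the string by one `!`** (a rank-1 multiplexor moving slot `k` to the fresh slot
`k + 1`, then the renaming back). [cite: GaboardiMarionRonchidellarocca2008, Table 2 (m)] -/
theorem zone_raise (hr : 1 ≤ r) (h : HT r (Ctx.zone m k L lv) M σ) :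
    HT r (Ctx.zone m k L (lv + 1)) M σ := by
  -- the multiplexor
  have h1 := h.mpx (σ := ⟨lv, tyS m⟩) {k} (k + 1) (fun i hi => by
    rw [Finset.mem_singleton] at hi; subst hi; exact Ctx.zone_self) (Ctx.zone_gt (by omega)) (by simpa using hr)
  -- the renaming back
  let ρ : ℕ → ℕ := fun i => if i = k + 1 then k else i
  have hsupp : ∀ i, (Ctx.zone m k L lv).mpx {k} (k + 1) ⟨lv, tyS m⟩ i ≠ none → (i < k ∧ L i ≠ none) ∨ i = k + 1 := by
    intro i hi
    by_cases hik : i = k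
    · subst hik; simp [Ctx.mpx] at hi
    · by_cases hik' : i = k + 1
      · exact Or.inr hik'
      · have : (Ctx.zone m k L lv).mpx {k} (k + 1) ⟨lv, tyS m⟩ i = Ctx.zone m k L lv i := by
          simp [Ctx.mpx, hik, hik']
        rw [this] at hi
        rcases Ctx.zone_ne_none hi with h' | h'
        · exact Or.inl h'
        · exact absurd h'.symm hik
  have hinj : ((Ctx.zone m k L lv).mpx {k} (k + 1) ⟨lv, tyS m⟩).InjOn ρ := by
    intro i₁ i₂ h₁ h₂ he
    rcases hsupp i₁ h₁ with ⟨h₁', -⟩ | rfl <;> rcases hsupp i₂ h₂ with ⟨h₂', -⟩ | rfl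
    · simpa [ρ, show i₁ ≠ k + 1 by omega, show i₂ ≠ k + 1 by omega] using he
    · simp [ρ, show i₁ ≠ k + 1 by omega] at he; omega
    · simp [ρ, show i₂ ≠ k + 1 by omega] at he; omega
    · rfl
  have h2 := h1.rename_ctx hinj
  have himg : ((Ctx.zone m k L lv).mpx {k} (k + 1) ⟨lv, tyS m⟩).image ρ = Ctx.zone m k L (lv + 1) := by
    refine Ctx.image_eq_of hinj (fun i hi => ?_) (fun i' hi' => ?_)
    · rcases hsupp i hi with ⟨hik, -⟩ | rfl
      · have hρ : ρ i = i := by simp [ρ, show i ≠ k + 1 by omega]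
        rw [hρ, Ctx.zone_lt hik]
        simp [Ctx.mpx, show i ≠ k by omega, show i ≠ k + 1 by omega, Ctx.zone_lt hik]
      · have hρ : ρ (k + 1) = k := by simp [ρ]
        rw [hρ, Ctx.zone_self]
        simp [Ctx.mpx, SoftTy.bang]
    · rcases Ctx.zone_ne_none hi' with ⟨hik, hL⟩ | rfl
      · refine ⟨i', ?_, by simp [ρ, show i' ≠ k + 1 by omega]⟩
        simpa [Ctx.mpx, show i' ≠ k by omega, show i' ≠ k + 1 by omega, Ctx.zone_lt hik] using hL
      · exact ⟨k + 1, by simp [Ctx.mpx], by simp [ρ]⟩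
  rw [himg, Term.rename_rename] at h2
  have hM : M.rename (ρ ∘ mpxRen {k} (k + 1)) = M := by
    refine Term.rename_eq_self_of_freeIn M fun i hi => ?_
    rcases Ctx.zone_ne_none (h.isSome_of_freeIn hi) with ⟨hik, -⟩ | rfl
    · simp [ρ, mpxRen, show i ≠ k by omega, show i ≠ k + 1 by omega]
    · simp [ρ, mpxRen]
  rwa [hM] at h2

/-- Raising the string to any higher level. [cite: GaboardiMarionRonchidellarocca2008, Table 2 (m)] -/
theorem zone_raise_le (hr : 1 ≤ r) (h : HT r (Ctx.zone m k L lv) M σ) {lv' : ℕ} (hle : lv ≤ lv') :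
    HT r (Ctx.zone m k L lv') M σ := by
  induction lv', hle using Nat.le_induction with
  | base => exact h
  | succ lv' _ ih => exact ih.zone_raise hr

/-- **Application sharing the string**: `(⊸E)` splitting the local part, the string being used on
both sides at the same level `lv`; the result has the string at level `lv + 1` (the copy in the
argument is renamed to the fresh slot `k + 1`, the application is formed, a rank-2 multiplexor
merges the two copies into `k + 2`, which is renamed back to `k`).
[cite: GaboardiMarionRonchidellarocca2008, Table 2 ((⊸E), (m))] -/
theorem zone_app (hr : 2 ≤ r) {L₁ L₂ : Ctx} (hs : L.Split L₁ L₂) {N : Term} {q : ℕ} {B A : LinTy}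
    (h₁ : HT r (Ctx.zone m k L₁ lv) M ⟨0, .limp q B A⟩) (h₂ : HT r (Ctx.zone m k L₂ lv) N ⟨q, B⟩) :
    HT r (Ctx.zone m k L (lv + 1)) (.app M N) ⟨0, A⟩ := by
  -- 1. rename the string of the argument to `k + 1`
  let ρ₁ : ℕ → ℕ := fun i => if i = k then k + 1 else i
  have hinj₁ : (Ctx.zone m k L₂ lv).InjOn ρ₁ := by
    intro i₁ i₂ hi₁ hi₂ he
    rcases Ctx.zone_ne_none hi₁ with ⟨h1, -⟩ | rfl <;> rcases Ctx.zone_ne_none hi₂ with ⟨h2, -⟩ | rfl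
    · simpa [ρ₁, show i₁ ≠ k by omega, show i₂ ≠ k by omega] using he
    · simp [ρ₁, show i₁ ≠ k by omega] at he; omega
    · simp [ρ₁, show i₂ ≠ k by omega] at he; omega
    · rfl
  let Γ₂ : Ctx := fun i => if i < k then L₂ i else if i = k + 1 then some ⟨lv, tyS m⟩ else none
  have himg₁ : (Ctx.zone m k L₂ lv).image ρ₁ = Γ₂ := by
    refine Ctx.image_eq_of hinj₁ (fun i hi => ?_) (fun i' hi' => ?_)
    · rcases Ctx.zone_ne_none hi with ⟨hik, -⟩ | rfl
      · simp [ρ₁, Γ₂, show i ≠ k by omega, hik, Ctx.zone_lt hik]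
      · simp [ρ₁, Γ₂]
    · by_cases hik : i' < k
      · refine ⟨i', ?_, by simp [ρ₁, show i' ≠ k by omega]⟩
        rw [Ctx.zone_lt hik]; simpa [Γ₂, hik] using hi'
      · by_cases hik' : i' = k + 1
        · exact ⟨k, by simp, by simp [ρ₁, hik']⟩
        · exact absurd (by simp [Γ₂, hik, hik']) hi'
  have h₂' := h₂.rename_ctx hinj₁
  rw [himg₁] at h₂'
  -- 2. the application
  let Γ : Ctx := fun i => if i < k then L i else if i = k ∨ i = k + 1 then some ⟨lv, tyS m⟩ else none
  have hsplit : Γ.Split (Ctx.zone m k L₁ lv) Γ₂ := by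
    intro i
    by_cases hik : i < k
    · rcases hs i with ⟨e₁, e₂⟩ | ⟨e₁, e₂⟩
      · exact Or.inl ⟨by rw [Ctx.zone_lt hik]; simp [Γ, hik, e₁], by simp [Γ₂, hik, e₂]⟩
      · exact Or.inr ⟨by rw [Ctx.zone_lt hik]; exact e₁, by simp [Γ, Γ₂, hik, e₂]⟩
    · by_cases h0 : i = k
      · subst h0; exact Or.inl ⟨by simp [Γ], by simp [Γ₂]⟩
      · by_cases h1 : i = k + 1
        · subst h1
          exact Or.inr ⟨Ctx.zone_gt (by omega), by simp [Γ, Γ₂]⟩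
        · exact Or.inl ⟨by rw [Ctx.zone_gt (by omega)]; simp [Γ, hik, h0, h1], by simp [Γ₂, hik, h1]⟩
  have happ := HT.app hsplit h₁ h₂'
  -- 3. merge the two copies into `k + 2`
  have hpair : ({k, k + 1} : Finset ℕ).card ≤ r := by
    rw [Finset.card_pair (by omega)]; exact hr
  have hmpx := happ.mpx (σ := ⟨lv, tyS m⟩) {k, k + 1} (k + 2)
    (fun i hi => by
      simp only [Finset.mem_insert, Finset.mem_singleton] at hi
      rcases hi with rfl | rfl <;> simp [Γ])
    (by simp [Γ]) hpair
  -- 4. rename `k + 2` back to `k`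
  let Γ₃ := Γ.mpx {k, k + 1} (k + 2) ⟨lv, tyS m⟩
  have hsupp₃ : ∀ i, Γ₃ i ≠ none → (i < k ∧ L i ≠ none) ∨ i = k + 2 := by
    intro i hi
    by_cases hik : i < k
    · left
      refine ⟨hik, ?_⟩
      simpa [Γ₃, Ctx.mpx, Γ, hik, show i ≠ k by omega, show i ≠ k + 1 by omega, show i ≠ k + 2 by omega] using hi
    · by_cases h2 : i = k + 2
      · exact Or.inr h2
      · exfalso; apply hi
        by_cases h0 : i = k
        · subst h0; simp [Γ₃, Ctx.mpx]
        · by_cases h1 : i = k + 1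
          · subst h1; simp [Γ₃, Ctx.mpx]
          · simp [Γ₃, Ctx.mpx, Γ, hik, h0, h1, h2]
  let ρ₃ : ℕ → ℕ := fun i => if i = k + 2 then k else i
  have hinj₃ : Γ₃.InjOn ρ₃ := by
    intro i₁ i₂ hi₁ hi₂ he
    rcases hsupp₃ i₁ hi₁ with ⟨h1, -⟩ | rfl <;> rcases hsupp₃ i₂ hi₂ with ⟨h2, -⟩ | rfl
    · simpa [ρ₃, show i₁ ≠ k + 2 by omega, show i₂ ≠ k + 2 by omega] using he
    · simp [ρ₃, show i₁ ≠ k + 2 by omega] at he; omega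
    · simp [ρ₃, show i₂ ≠ k + 2 by omega] at he; omega
    · rfl
  have himg₃ : Γ₃.image ρ₃ = Ctx.zone m k L (lv + 1) := by
    refine Ctx.image_eq_of hinj₃ (fun i hi => ?_) (fun i' hi' => ?_)
    · rcases hsupp₃ i hi with ⟨hik, -⟩ | rfl
      · have : ρ₃ i = i := by simp [ρ₃, show i ≠ k + 2 by omega]
        rw [this, Ctx.zone_lt hik]
        simp [Γ₃, Ctx.mpx, Γ, hik, show i ≠ k by omega, show i ≠ k + 1 by omega, show i ≠ k + 2 by omega]
      · have : ρ₃ (k + 2) = k := by simp [ρ₃]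
        rw [this, Ctx.zone_self]
        simp [Γ₃, Ctx.mpx, SoftTy.bang]
    · rcases Ctx.zone_ne_none hi' with ⟨hik, hL⟩ | rfl
      · refine ⟨i', ?_, by simp [ρ₃, show i' ≠ k + 2 by omega]⟩
        simpa [Γ₃, Ctx.mpx, Γ, hik, show i' ≠ k by omega, show i' ≠ k + 1 by omega, show i' ≠ k + 2 by omega] using hL
      · exact ⟨k + 2, by simp [Γ₃, Ctx.mpx], by simp [ρ₃]⟩
  have hfin := hmpx.rename_ctx hinj₃
  rw [himg₃, Term.rename_rename] at hfin
  -- the subject is `M N` again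
  have hM : M.rename (ρ₃ ∘ mpxRen {k, k + 1} (k + 2)) = M := by
    refine Term.rename_eq_self_of_freeIn M fun i hi => ?_
    rcases Ctx.zone_ne_none (h₁.isSome_of_freeIn hi) with ⟨hik, -⟩ | rfl
    · simp [ρ₃, mpxRen, show i ≠ k by omega, show i ≠ k + 1 by omega, show i ≠ k + 2 by omega]
    · simp [ρ₃, mpxRen]
  have hN : (N.rename ρ₁).rename (ρ₃ ∘ mpxRen {k, k + 1} (k + 2)) = N := by
    rw [Term.rename_rename]
    refine Term.rename_eq_self_of_freeIn N fun i hi => ?_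
    rcases Ctx.zone_ne_none (h₂.isSome_of_freeIn hi) with ⟨hik, -⟩ | rfl
    · simp [ρ₁, ρ₃, mpxRen, show i ≠ k by omega, show i ≠ k + 1 by omega, show i ≠ k + 2 by omega]
    · simp [ρ₁, ρ₃, mpxRen]
  simpa [Term.rename, hM, hN] using hfin

end HT

/-! ### `HTz`: the string at some level -/

/-- `HTz r m k L M σ`: `L, s : !ˡᵛ S_m ⊢ M : σ` for SOME level `lv`, the string `s` being the
variable `k` (binder depth `k`) and `L` the local assumptions on the slots `< k`.
[cite: GaboardiMarionRonchidellarocca2008, Thm. 3.9] -/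
def HTz (r m k : ℕ) (L : Ctx) (M : Term) (σ : SoftTy) : Prop := ∃ lv, HT r (Ctx.zone m k L lv) M σ

namespace HTz

variable {r m k : ℕ} {L : Ctx} {M : Term} {σ : SoftTy}

/-- The subject is sum-free. [folklore] -/
theorem sumFree (h : HTz r m k L M σ) : M.SumFree := by
  obtain ⟨_, h⟩ := h
  exact h.sumFree

/-- Free variables are local slots or the string. [folklore] -/
theorem freeIn (h : HTz r m k L M σ) {i : ℕ} (hi : M.FreeIn i) : (i < k ∧ L i ≠ none) ∨ k = i := by
  obtain ⟨_, h⟩ := h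
  exact Ctx.zone_ne_none (h.isSome_of_freeIn hi)

/-- From a derivation whose context lies inside the zone context (at level `0`). [folklore] -/
theorem ofHT {Γ : Ctx} (h : HT r Γ M σ) (hΓ : ∀ i, Γ i ≠ none → Ctx.zone m k L 0 i = Γ i) : HTz r m k L M σ :=
  ⟨0, h.extend hΓ (Ctx.zone_boundedBy m k L 0)⟩

/-- Closed terms. [folklore] -/
theorem ofClosed (h : HT r Ctx.empty M σ) : HTz r m k L M σ :=
  ofHT h fun _ hi => absurd rfl hi

/-- A local linear variable. [cite: GaboardiMarionRonchidellarocca2008, Table 2 (Ax)] -/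
theorem lvar {i : ℕ} (hi : i < k) {A : LinTy} (hL : L i = some ⟨0, A⟩) : HTz r m k L (.var i) ⟨0, A⟩ := by
  refine ofHT (Γ := fun j => if j = i then some ⟨0, A⟩ else none) (HT.var ⟨by simp, fun j hj => by simp [hj]⟩) ?_
  intro j hj
  by_cases hji : j = i
  · subst hji; rw [Ctx.zone_lt hi, hL]; simp
  · simp [hji] at hj

/-- **The string itself**: `s : S_m` (the axiom at level `0`; any level by raising).
[cite: GaboardiMarionRonchidellarocca2008, Table 2 (Ax), (m)] -/
theorem svar : HTz r m k L (.var k) ⟨0, tyS m⟩ := by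
  refine ofHT (Γ := fun j => if j = k then some ⟨0, tyS m⟩ else none) (HT.var ⟨by simp, fun j hj => by simp [hj]⟩) ?_
  intro j hj
  by_cases hjk : j = k
  · subst hjk; simp
  · simp [hjk] at hj

/-- Changing / weakening the local part on unused slots. [cite: GaboardiMarionRonchidellarocca2008, Table 2 (w), (m)] -/
theorem weakenL (h : HTz r m k L M σ) {L' : Ctx} (hL : ∀ i < k, L i ≠ none → L' i = L i) : HTz r m k L' M σ := by
  obtain ⟨lv, h⟩ := h
  refine ⟨lv, h.extend (fun i hi => ?_) (Ctx.zone_boundedBy m k L' lv)⟩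
  rcases Ctx.zone_ne_none hi with ⟨hik, hLi⟩ | rfl
  · rw [Ctx.zone_lt hik, Ctx.zone_lt hik, hL i hik hLi]
  · simp

/-- The local part only matters below `k`. [folklore] -/
theorem congrL (h : HTz r m k L M σ) {L' : Ctx} (hL : ∀ i < k, L i = L' i) : HTz r m k L' M σ := by
  obtain ⟨lv, h⟩ := h
  exact ⟨lv, Ctx.zone_congr hL m lv ▸ h⟩

/-- Raising the rank bound. [folklore] -/
theorem mono_rank (h : HTz r m k L M σ) {r' : ℕ} (hr : r ≤ r') : HTz r' m k L M σ := by
  obtain ⟨lv, h⟩ := h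
  exact ⟨lv, h.mono_rank hr⟩

/-- **Rule `(⊸E)` sharing the string** (local part split, string multiplexed).
[cite: GaboardiMarionRonchidellarocca2008, Table 2 ((⊸E), (m))] -/
theorem app (hr : 2 ≤ r) {L₁ L₂ : Ctx} (hs : L.Split L₁ L₂) {N : Term} {q : ℕ} {B A : LinTy}
    (h₁ : HTz r m k L₁ M ⟨0, .limp q B A⟩) (h₂ : HTz r m k L₂ N ⟨q, B⟩) : HTz r m k L (.app M N) ⟨0, A⟩ := by
  obtain ⟨lv₁, h₁⟩ := h₁
  obtain ⟨lv₂, h₂⟩ := h₂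
  have hr1 : 1 ≤ r := by omega
  exact ⟨max lv₁ lv₂ + 1, HT.zone_app hr hs (h₁.zone_raise_le hr1 (le_max_left _ _))
    (h₂.zone_raise_le hr1 (le_max_right _ _))⟩

/-- `(⊸E)` with a closed function (no multiplexor needed). [cite: GaboardiMarionRonchidellarocca2008, Table 2 (⊸E)] -/
theorem app_closed_fun {N : Term} {q : ℕ} {B A : LinTy} (h₁ : HT r Ctx.empty M ⟨0, .limp q B A⟩)
    (h₂ : HTz r m k L N ⟨q, B⟩) : HTz r m k L (.app M N) ⟨0, A⟩ := by
  obtain ⟨lv, h₂⟩ := h₂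
  exact ⟨lv, h₁.app_fun_closed h₂⟩

/-- `(⊸E)` with a closed argument. [cite: GaboardiMarionRonchidellarocca2008, Table 2 (⊸E)] -/
theorem app_closed_arg {N : Term} {q : ℕ} {B A : LinTy} (h₁ : HTz r m k L M ⟨0, .limp q B A⟩)
    (h₂ : HT r Ctx.empty N ⟨q, B⟩) : HTz r m k L (.app M N) ⟨0, A⟩ := by
  obtain ⟨lv, h₁⟩ := h₁
  exact ⟨lv, h₁.app_arg_closed h₂⟩

/-- `(⊸E)` where only the function uses the context (argument closed-or-string-free typed in the
empty local part is NOT assumed; here the argument uses no local slot and no string).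
A spine of closed arguments. [folklore] -/
theorem apps_closed {σs : List SoftTy} {A : LinTy} {Ns : List Term}
    (h : HTz r m k L M ⟨0, LinTy.arrows σs A⟩) (hlen : Ns.length = σs.length)
    (hNs : ∀ i (hi : i < Ns.length), HT r Ctx.empty (Ns.get ⟨i, hi⟩) (σs.get ⟨i, hlen ▸ hi⟩)) :
    HTz r m k L (M.apps Ns) ⟨0, A⟩ := by
  obtain ⟨lv, h⟩ := h
  exact ⟨lv, h.apps_closed hlen hNs⟩

/-- **Rule `(⊸I)`** at depth `k`: the bound variable is the local slot `0` at depth `k + 1`.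
[cite: GaboardiMarionRonchidellarocca2008, Table 2 (⊸I)] -/
theorem lam {τ : SoftTy} {A : LinTy} (h : HTz r m (k + 1) (Ctx.cons (some τ) L) M ⟨0, A⟩) :
    HTz r m k L (.lam M) ⟨0, .limp τ.bangs τ.lin A⟩ := by
  obtain ⟨lv, h⟩ := h
  rw [← Ctx.cons_zone] at h
  exact ⟨lv, HT.lam h⟩

/-- Carrying a term under a new (unused) binder. [folklore] -/
theorem shift_succ (h : HTz r m k L M σ) (a : Option SoftTy) :
    HTz r m (k + 1) (Ctx.cons a L) (M.rename Nat.succ) σ := by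
  obtain ⟨lv, h⟩ := h
  have h1 := h.shift_succ
  rw [Ctx.cons_zone] at h1
  refine HTz.weakenL ⟨lv, h1⟩ fun i hi hne => ?_
  cases i with
  | zero => exact absurd rfl hne
  | succ i => rfl

/-- **Rule `(sp)`**: the locals and the string are promoted. [cite: GaboardiMarionRonchidellarocca2008, Table 2 (sp)] -/
theorem box {q : ℕ} {A : LinTy} (h : HTz r m k L M ⟨q, A⟩) : HTz r m k L.bang M ⟨q + 1, A⟩ := by
  obtain ⟨lv, h⟩ := h
  have h1 := h.sp
  rw [Ctx.zone_bang] at h1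
  exact ⟨lv + 1, h1⟩

/-- Iterated `(sp)`. [cite: GaboardiMarionRonchidellarocca2008, Table 2 (sp)] -/
theorem boxN {q : ℕ} {A : LinTy} (h : HTz r m k L M ⟨q, A⟩) (n : ℕ) :
    HTz r m k (Ctx.bang^[n] L) M ⟨q + n, A⟩ := by
  induction n with
  | zero => exact h
  | succ n ih =>
    have := ih.box
    rw [← Function.iterate_succ_apply' Ctx.bang] at this
    simpa [Nat.add_assoc] using this

/-- **Rule `(∀I)`** (the string type is closed). [cite: GaboardiMarionRonchidellarocca2008, Table 2 (∀I)] -/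
theorem allI {A : LinTy} (h : HTz r m k L.shift M ⟨0, A⟩) : HTz r m k L M ⟨0, .all A⟩ := by
  obtain ⟨lv, h⟩ := h
  rw [← Ctx.zone_shift] at h
  exact ⟨lv, HT.allI h⟩

/-- **Rule `(∀E)`**. [cite: GaboardiMarionRonchidellarocca2008, Table 2 (∀E)] -/
theorem allE {B : LinTy} (A : LinTy) (h : HTz r m k L M ⟨0, .all B⟩) : HTz r m k L M ⟨0, B.inst A⟩ := by
  obtain ⟨lv, h⟩ := h
  exact ⟨lv, h.allE A⟩

/-- **Closing the program**: abstracting the string at depth `0` gives `⊢ λs.M : !ᴾ S_m ⊸ A` for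
some level `P`. [cite: GaboardiMarionRonchidellarocca2008, Thm. 3.9] -/
theorem close {A : LinTy} (h : HTz r m 0 Ctx.empty M ⟨0, A⟩) :
    ∃ P, HT r Ctx.empty (.lam M) ⟨0, .limp P (tyS m) A⟩ := by
  obtain ⟨lv, h⟩ := h
  rw [Ctx.zone_zero] at h
  exact ⟨lv, HT.lam (σ := ⟨lv, tyS m⟩) h⟩

end HTz

end STA

end Literature.Computability.ImplicitComplexity
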